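import Summits.KontsevichZagierPeriods.KontsevichZagierPeriods.Theorems.LinRedNormalFormArrangementNormalFormStubRebaseSimpleZeroNestedSection

/-!
# Stub `stub_rebaseSimpleZero`, part `rebaseSimpleZero_nested2` (crux `ArrangementNormalForm`,
line `janus-bands`, v6.2) — brick `NestedJanus`

Signed Janus dissection of a NESTED pair `A < tᵢ < tⱼ < B` (literal `GG B σ 2` datum, any
silent base dimension) by a letter-parallel SUB-section `T ≤ A ≤ B` (all letters of `y`-slope
`λ`, `T = λ y + κ(x')`): in `KZ.relations`,
`[A<tᵢ<tⱼ<B] = [T<tᵢ<tⱼ<B] − [T<tᵢ<tⱼ<A] − [T<tᵢ<A]×[T<tⱼ<B] + [T<tᵢ<A]×[T<tⱼ<A]`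
(rule 1a three times: the ties `tᵢ = A`, `tⱼ = A` are null), and each cell on the right has ONE
letter-transverse pivot per linked component, hence is good for `GG B 2 2`
(`RebaseNest.good_pivot(s)`). The only analytic input is the absolute convergence of the literal
integrand on the box `{T < tᵢ < B} × {T < tⱼ < B}` (hypothesis `hW`; at a pinch `A = B` on the
boundary of the base cell this is the cone estimate of the caller). Registered on the literal
class text as `rebaseSimpleZero_nestedSubJanus`.

References: M. Kontsevich, D. Zagier, *Periods* (2001), §1.2, rules (1a), (2).
-/

noncomputable section

open Set MeasureTheory MvPolynomial
open Literature.NumberTheory.Transcendental Literature.ModelTheory.ExponentialFields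

namespace Summit.KontsevichZagierPeriods.ArrangementNormalForm.JanusBands

namespace RebaseNest

open SeparatePos RebasePos

section Split

variable {n : ℕ}

/-- **Rule (1a) with two pieces**: if `D₁, D₂ ⊆ σ` are disjoint semialgebraic sets covering `σ`
up to a null set, `[r] − [r|D₁] − [r|D₂] ∈ KZ.relations`. [Kontsevich–Zagier 2001, §1.2, rule (1)] -/
theorem of_sub_restrict_sub_restrict (r : KZ.IntegralRep n) {D₁ D₂ : Set (Fin n → ℝ)}
    (h₁ : IsSemialgebraic ℚ D₁) (h₂ : IsSemialgebraic ℚ D₂) (hs₁ : D₁ ⊆ r.domain) (hs₂ : D₂ ⊆ r.domain)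
    (hdisj : D₁ ∩ D₂ = ∅) (hcov : volume (r.domain \ (D₁ ∪ D₂)) = 0) :
    KZ.of r - KZ.of (r.restrict D₁ h₁ hs₁) - KZ.of (r.restrict D₂ h₂ hs₂) ∈ KZ.relations := by
  set R : Fin 2 → KZ.IntegralRep n := ![r.restrict D₁ h₁ hs₁, r.restrict D₂ h₂ hs₂] with hR
  have h := KZ.of_sub_sum_of_mem_relations Finset.univ r R
    (fun k _ => by fin_cases k <;> simp [hR, sdiff_eq_empty.2 hs₁, sdiff_eq_empty.2 hs₂])
    (fun k _ _ _ => by fin_cases k <;> rfl)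
    (measure_mono_null (sdiff_subset_sdiff_right (union_subset
      (fun z hz => mem_iUnion₂.2 ⟨0, Finset.mem_univ _, hz⟩)
      (fun z hz => mem_iUnion₂.2 ⟨1, Finset.mem_univ _, hz⟩))) hcov)
    (fun k _ k' _ hkk' => by
      show volume ((R k).domain ∩ (R k').domain) = 0
      fin_cases k <;> fin_cases k'
      · exact absurd rfl hkk'
      · simp [hR, hdisj]
      · simp [hR, inter_comm D₂, hdisj]
      · exact absurd rfl hkk')
  rw [Fin.sum_univ_two] at h
  simpa [hR, sub_sub] using h

end Split

section SubJanus

variable {B m m' : ℕ} {i j : Fin 2} {n₁ n₂ : ℕ} (s : KZ.IntegralRep (B + 1 + 2))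
  (M : Fin m' → (Fin (B + 1) → ℚ) × ℚ) (L : Fin m → (Fin B → ℚ) × ℚ) (e : Fin m → ℕ)
  (p : MvPolynomial (Fin B) ℚ) (ℓ₁ ℓ₂ : (Fin B → ℚ) × ℚ) (a : Fin 2 → Option ((Fin (B + 1) → ℚ) × ℚ))
  (lo hi : Fin 2 → Fin 2 ⊕ ((Fin (B + 1) → ℚ) × ℚ)) (h12 : n₁ = 0 ∨ n₂ = 0)
  (hdom : s.domain = gDom B 2 m' M lo hi) (hint : EqOn s.integrand (glit B 2 p L e ℓ₁ ℓ₂ n₁ n₂ a) s.domain)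
  (hij : i ≠ j) (A Bd T : (Fin (B + 1) → ℚ) × ℚ) (lam : ℚ)
  (hloi : lo i = Sum.inr A) (hhii : hi i = Sum.inl j) (hloj : lo j = Sum.inl i) (hhij : hi j = Sum.inr Bd)
  (ha : ∀ l c, a l = some c → c.1 (Fin.last B) = lam) (hT : T.1 (Fin.last B) = lam)
  (hTA : ∀ z, (∀ r, 0 < affF B 2 (M r) z) → affF B 2 T z ≤ affF B 2 A z)
  (hAB : ∀ z, (∀ r, 0 < affF B 2 (M r) z) → affF B 2 A z ≤ affF B 2 Bd z)
  (hW : IntegrableOn (glit B 2 p L e ℓ₁ ℓ₂ n₁ n₂ a) (gDom B 2 m' M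
    (Function.update (Function.update lo i (Sum.inr T)) j (Sum.inr T))
    (Function.update (Function.update hi i (Sum.inr Bd)) j (Sum.inr Bd))))
  (hbox : Bornology.IsBounded (gDom B 2 m' M
    (Function.update (Function.update lo i (Sum.inr T)) j (Sum.inr T))
    (Function.update (Function.update hi i (Sum.inr Bd)) j (Sum.inr Bd))))

/-- Membership in a literal two-fibre PRODUCT domain with affine bounds `u < tᵢ < v`,
`u' < tⱼ < v'`, written with updates of arbitrary bound data. -/
theorem mem_box (hij : i ≠ j) (lo₀ hi₀ : Fin 2 → Fin 2 ⊕ ((Fin (B + 1) → ℚ) × ℚ))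
    (u v u' v' : (Fin (B + 1) → ℚ) × ℚ) (z : Fin (B + 1 + 2) → ℝ) :
    z ∈ gDom B 2 m' M (Function.update (Function.update lo₀ i (Sum.inr u)) j (Sum.inr u'))
      (Function.update (Function.update hi₀ i (Sum.inr v)) j (Sum.inr v')) ↔
    (∀ r, 0 < affF B 2 (M r) z) ∧
      (affF B 2 u z < z (Fin.natAdd (B + 1) i) ∧ z (Fin.natAdd (B + 1) i) < affF B 2 v z) ∧
      (affF B 2 u' z < z (Fin.natAdd (B + 1) j) ∧ z (Fin.natAdd (B + 1) j) < affF B 2 v' z) := by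
  rw [mem_gDom_pair hij]
  simp only [Function.update_self, Function.update_of_ne hij, pv_inr]

/-- Membership in a literal NESTED domain `u < tᵢ < tⱼ < v'`, written with updates. -/
theorem mem_nestU (hij : i ≠ j) (lo₀ hi₀ : Fin 2 → Fin 2 ⊕ ((Fin (B + 1) → ℚ) × ℚ))
    (u v' : (Fin (B + 1) → ℚ) × ℚ) (z : Fin (B + 1 + 2) → ℝ) :
    z ∈ gDom B 2 m' M (Function.update (Function.update lo₀ i (Sum.inr u)) j (Sum.inl i))
      (Function.update (Function.update hi₀ i (Sum.inl j)) j (Sum.inr v')) ↔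
    (∀ r, 0 < affF B 2 (M r) z) ∧
      (affF B 2 u z < z (Fin.natAdd (B + 1) i) ∧ z (Fin.natAdd (B + 1) i) < z (Fin.natAdd (B + 1) j)) ∧
      (z (Fin.natAdd (B + 1) i) < z (Fin.natAdd (B + 1) j) ∧ z (Fin.natAdd (B + 1) j) < affF B 2 v' z) := by
  rw [mem_gDom_pair hij]
  simp only [Function.update_self, Function.update_of_ne hij, pv_inr, pv_inl]

/-- Membership in a literal HALF-NESTED domain `u < tᵢ < v`, `tᵢ < tⱼ < v'`, with updates. -/
theorem mem_halfU (hij : i ≠ j) (lo₀ hi₀ : Fin 2 → Fin 2 ⊕ ((Fin (B + 1) → ℚ) × ℚ))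
    (u v v' : (Fin (B + 1) → ℚ) × ℚ) (z : Fin (B + 1 + 2) → ℝ) :
    z ∈ gDom B 2 m' M (Function.update (Function.update lo₀ i (Sum.inr u)) j (Sum.inl i))
      (Function.update (Function.update hi₀ i (Sum.inr v)) j (Sum.inr v')) ↔
    (∀ r, 0 < affF B 2 (M r) z) ∧
      (affF B 2 u z < z (Fin.natAdd (B + 1) i) ∧ z (Fin.natAdd (B + 1) i) < affF B 2 v z) ∧
      (z (Fin.natAdd (B + 1) i) < z (Fin.natAdd (B + 1) j) ∧ z (Fin.natAdd (B + 1) j) < affF B 2 v' z) := by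
  rw [mem_gDom_pair hij]
  simp only [Function.update_self, Function.update_of_ne hij, pv_inr, pv_inl]

/-- Differences of good elements are good. [folklore] -/
theorem good_sub {T : Set KZ.FormalRep} {x y : KZ.FormalRep}
    (hx : ∃ c ∈ AddSubgroup.closure T, x - c ∈ KZ.relations)
    (hy : ∃ c ∈ AddSubgroup.closure T, y - c ∈ KZ.relations) :
    ∃ c ∈ AddSubgroup.closure T, x - y - c ∈ KZ.relations := by
  obtain ⟨c, hc, hxc⟩ := hx
  obtain ⟨d, hd, hyd⟩ := hy
  refine ⟨c - d, sub_mem hc hd, ?_⟩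
  have := sub_mem hxc hyd
  rwa [show x - c - (y - d) = x - y - (c - d) by abel] at this

include h12 hdom hint hij hloi hhii hloj hhij ha hT hTA hAB hW hbox in
/-- **Sub-section Janus for a nested pair** (rules 1a + 2). Let `A < tᵢ < tⱼ < B` be a nested
pair with letters of common `y`-slope `λ` and let `T = λ y + κ(x')` be a letter-parallel form
with `T ≤ A ≤ B` on the base cell. If the literal integrand converges absolutely on the box
`{T < tᵢ < B} × {T < tⱼ < B}`, then modulo `KZ.relations`
`[A<tᵢ<tⱼ<B] = [T<tᵢ<tⱼ<B] − [T<tᵢ<tⱼ<A] − [T<tᵢ<A]×[T<tⱼ<B] + [T<tᵢ<A]×[T<tⱼ<A]`, and the four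
cells on the right are good for `GG B 2 2` (one pivot per linked component).
[Kontsevich–Zagier 2001, §1.2, rules (1), (2)] -/
theorem subJanus : ∃ c ∈ AddSubgroup.closure (GGset B 2 2), KZ.of s - c ∈ KZ.relations := by
  -- notation
  set f := glit B 2 p L e ℓ₁ ℓ₂ n₁ n₂ a with hf
  set lT : Fin 2 → Fin 2 ⊕ ((Fin (B + 1) → ℚ) × ℚ) := Function.update lo i (Sum.inr T) with hlT
  set hA : Fin 2 → Fin 2 ⊕ ((Fin (B + 1) → ℚ) × ℚ) := Function.update hi i (Sum.inr A) with hhA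
  set hB : Fin 2 → Fin 2 ⊕ ((Fin (B + 1) → ℚ) × ℚ) := Function.update hi i (Sum.inr Bd) with hhB
  set hJ : Fin 2 → Fin 2 ⊕ ((Fin (B + 1) → ℚ) × ℚ) := Function.update hi i (Sum.inl j) with hhJ
  set Box := gDom B 2 m' M (Function.update lT j (Sum.inr T)) (Function.update hB j (Sum.inr Bd))
    with hBox
  set T₁ := gDom B 2 m' M (Function.update lT j (Sum.inl i)) (Function.update hJ j (Sum.inr Bd)) with hT₁
  set X := gDom B 2 m' M (Function.update lT j (Sum.inl i)) (Function.update hA j (Sum.inr Bd)) with hX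
  set Q₁ := gDom B 2 m' M (Function.update lT j (Sum.inl i)) (Function.update hJ j (Sum.inr A)) with hQ₁
  set Y := gDom B 2 m' M (Function.update lT j (Sum.inr A)) (Function.update hA j (Sum.inr Bd)) with hY
  set Q₂ := gDom B 2 m' M (Function.update lT j (Sum.inr T)) (Function.update hA j (Sum.inr Bd)) with hQ₂
  set Q₃ := gDom B 2 m' M (Function.update lT j (Sum.inr T)) (Function.update hA j (Sum.inr A)) with hQ₃
  -- membership
  have mBox := mem_box M hij lo hi T Bd T Bd
  have mT₁ := mem_nestU M hij lo hi T Bd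
  have mX := mem_halfU M hij lo hi T A Bd
  have mQ₁ := mem_nestU M hij lo hi T A
  have mY := mem_box M hij lo hi T A A Bd
  have mQ₂ := mem_box M hij lo hi T A T Bd
  have mQ₃ := mem_box M hij lo hi T A T A
  have mP := mem_nest M lo hi hij A Bd hloi hhii hloj hhij
  simp only [← hlT, ← hhA, ← hhB, ← hhJ] at mBox mT₁ mX mQ₁ mY mQ₂ mQ₃
  simp only [← hBox, ← hT₁, ← hX, ← hQ₁, ← hY, ← hQ₂, ← hQ₃] at mBox mT₁ mX mQ₁ mY mQ₂ mQ₃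
  -- inclusions
  have sT₁ : T₁ ⊆ Box := fun z hz => by
    obtain ⟨hr, ⟨h1, h2⟩, -, h4⟩ := (mT₁ z).1 hz
    exact (mBox z).2 ⟨hr, ⟨h1, h2.trans h4⟩, h1.trans h2, h4⟩
  have sP : s.domain ⊆ T₁ := fun z hz => by
    obtain ⟨hr, ⟨h1, h2⟩, -, h4⟩ := (mP z).1 (hdom ▸ hz)
    exact (mT₁ z).2 ⟨hr, ⟨(hTA z hr).trans_lt h1, h2⟩, h2, h4⟩
  have sX : X ⊆ T₁ := fun z hz => by
    obtain ⟨hr, ⟨h1, -⟩, h3, h4⟩ := (mX z).1 hz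
    exact (mT₁ z).2 ⟨hr, ⟨h1, h3⟩, h3, h4⟩
  have sQ₁ : Q₁ ⊆ X := fun z hz => by
    obtain ⟨hr, ⟨h1, h2⟩, -, h4⟩ := (mQ₁ z).1 hz
    exact (mX z).2 ⟨hr, ⟨h1, h2.trans h4⟩, h2, h4.trans_le (hAB z hr)⟩
  have sY : Y ⊆ X := fun z hz => by
    obtain ⟨hr, ⟨h1, h2⟩, h3, h4⟩ := (mY z).1 hz
    exact (mX z).2 ⟨hr, ⟨h1, h2⟩, h2.trans h3, h4⟩
  have sQ₂ : Q₂ ⊆ Box := fun z hz => by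
    obtain ⟨hr, ⟨h1, h2⟩, h3, h4⟩ := (mQ₂ z).1 hz
    exact (mBox z).2 ⟨hr, ⟨h1, h2.trans_le (hAB z hr)⟩, h3, h4⟩
  have sY₂ : Y ⊆ Q₂ := fun z hz => by
    obtain ⟨hr, ⟨h1, h2⟩, h3, h4⟩ := (mY z).1 hz
    exact (mQ₂ z).2 ⟨hr, ⟨h1, h2⟩, (hTA z hr).trans_lt h3, h4⟩
  have sQ₃ : Q₃ ⊆ Q₂ := fun z hz => by
    obtain ⟨hr, ⟨h1, h2⟩, h3, h4⟩ := (mQ₃ z).1 hz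
    exact (mQ₂ z).2 ⟨hr, ⟨h1, h2⟩, h3, h4.trans_le (hAB z hr)⟩
  -- the representations
  have hsa : ∀ (l₀ h₀ : Fin 2 → Fin 2 ⊕ ((Fin (B + 1) → ℚ) × ℚ)), IsSemialgebraic ℚ (gDom B 2 m' M l₀ h₀) :=
    fun l₀ h₀ => isSemialgebraic_gDom m' M l₀ h₀
  set rBox : KZ.IntegralRep (B + 1 + 2) :=
    ⟨Box, f, hsa _ _, isSemialgebraicFunOn_glit (hsa _ _) _ _ _ _ _ _ _ _, hW⟩ with hrBox
  set rT₁ := rBox.restrict T₁ (hsa _ _) sT₁ with hrT₁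
  set rP := rT₁.restrict s.domain (hdom ▸ hsa _ _) sP with hrP
  set rX := rT₁.restrict X (hsa _ _) sX with hrX
  set rQ₁ := rX.restrict Q₁ (hsa _ _) sQ₁ with hrQ₁
  set rY := rX.restrict Y (hsa _ _) sY with hrY
  set rQ₂ := rBox.restrict Q₂ (hsa _ _) sQ₂ with hrQ₂
  set rY₂ := rQ₂.restrict Y (hsa _ _) sY₂ with hrY₂
  set rQ₃ := rQ₂.restrict Q₃ (hsa _ _) sQ₃ with hrQ₃
  -- the three ties are null
  have hNi : volume {z : Fin (B + 1 + 2) → ℝ | z (Fin.natAdd (B + 1) i) = affF B 2 A z} = 0 :=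
    volume_fibre_eq_affF i A
  have hNj : volume {z : Fin (B + 1 + 2) → ℝ | z (Fin.natAdd (B + 1) j) = affF B 2 A z} = 0 :=
    volume_fibre_eq_affF j A
  -- rule (1a), three times
  have e₁ : KZ.of rT₁ - KZ.of rP - KZ.of rX ∈ KZ.relations := by
    refine of_sub_restrict_sub_restrict rT₁ (hdom ▸ hsa _ _) (hsa _ _) sP sX
      (eq_empty_of_forall_notMem fun z ⟨hz, hz'⟩ => ?_) (measure_mono_null (fun z hz => ?_) hNi)
    · have h1 := ((mP z).1 (hdom ▸ hz)).2.1.1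
      have h2 := ((mX z).1 hz').2.1.2
      exact lt_irrefl _ (h1.trans h2)
    · obtain ⟨hz, hz'⟩ := hz
      obtain ⟨hr, ⟨h1, h2⟩, -, h4⟩ := (mT₁ z).1 hz
      rcases lt_trichotomy (z (Fin.natAdd (B + 1) i)) (affF B 2 A z) with h | h | h
      · exact absurd (Or.inr ((mX z).2 ⟨hr, ⟨h1, h⟩, h2, h4⟩)) hz'
      · exact h
      · exact absurd (Or.inl (hdom ▸ (mP z).2 ⟨hr, ⟨h, h2⟩, h2, h4⟩)) hz'
  have e₂ : KZ.of rX - KZ.of rQ₁ - KZ.of rY ∈ KZ.relations := by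
    refine of_sub_restrict_sub_restrict rX (hsa _ _) (hsa _ _) sQ₁ sY
      (eq_empty_of_forall_notMem fun z ⟨hz, hz'⟩ => ?_) (measure_mono_null (fun z hz => ?_) hNj)
    · have h1 := ((mQ₁ z).1 hz).2.2.2
      have h2 := ((mY z).1 hz').2.2.1
      exact lt_irrefl _ (h1.trans h2)
    · obtain ⟨hz, hz'⟩ := hz
      obtain ⟨hr, ⟨h1, h2⟩, h3, h4⟩ := (mX z).1 hz
      rcases lt_trichotomy (z (Fin.natAdd (B + 1) j)) (affF B 2 A z) with h | h | h
      · exact absurd (Or.inl ((mQ₁ z).2 ⟨hr, ⟨h1, h3⟩, h3, h⟩)) hz'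
      · exact h
      · exact absurd (Or.inr ((mY z).2 ⟨hr, ⟨h1, h2⟩, h, h4⟩)) hz'
  have e₃ : KZ.of rQ₂ - KZ.of rY₂ - KZ.of rQ₃ ∈ KZ.relations := by
    refine of_sub_restrict_sub_restrict rQ₂ (hsa _ _) (hsa _ _) sY₂ sQ₃
      (eq_empty_of_forall_notMem fun z ⟨hz, hz'⟩ => ?_) (measure_mono_null (fun z hz => ?_) hNj)
    · have h1 := ((mY z).1 hz).2.2.1
      have h2 := ((mQ₃ z).1 hz').2.2.2
      exact lt_irrefl _ (h1.trans h2)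
    · obtain ⟨hz, hz'⟩ := hz
      obtain ⟨hr, ⟨h1, h2⟩, h3, h4⟩ := (mQ₂ z).1 hz
      rcases lt_trichotomy (z (Fin.natAdd (B + 1) j)) (affF B 2 A z) with h | h | h
      · exact absurd (Or.inr ((mQ₃ z).2 ⟨hr, ⟨h1, h2⟩, h3, h⟩)) hz'
      · exact h
      · exact absurd (Or.inl ((mY z).2 ⟨hr, ⟨h1, h2⟩, h, h4⟩)) hz'
  have e₀ : KZ.of s - KZ.of rP ∈ KZ.relations := KZ.of_sub_of_mem_relations_of_eqOn rfl hint
  have e₄ : KZ.of rY - KZ.of rY₂ ∈ KZ.relations := KZ.of_sub_of_mem_relations_of_eqOn rfl fun _ _ => rfl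
  -- the four cells are good
  have gT₁ : ∃ c ∈ AddSubgroup.closure (GGset B 2 2), KZ.of rT₁ - c ∈ KZ.relations := by
    refine good_pivot rT₁ M L e p ℓ₁ ℓ₂ a _ _ h12 (hbox.subset sT₁) rfl (fun _ _ => rfl) Bd lam ha
      fun l c hc => ?_
    rcases fin_two_eq_or hij l with rfl | rfl
    · simp only [hlT, hhJ, Function.update_of_ne hij, Function.update_self] at hc
      rcases hc with hc | hc <;> cases hc; exact Or.inr hT
    · simp only [Function.update_self] at hc
      rcases hc with hc | hc <;> cases hc; exact Or.inl rfl
  have gQ₁ : ∃ c ∈ AddSubgroup.closure (GGset B 2 2), KZ.of rQ₁ - c ∈ KZ.relations := by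
    refine good_pivot rQ₁ M L e p ℓ₁ ℓ₂ a _ _ h12 (hbox.subset ((sQ₁.trans sX).trans sT₁)) rfl
      (fun _ _ => rfl) A lam ha fun l c hc => ?_
    rcases fin_two_eq_or hij l with rfl | rfl
    · simp only [hlT, hhJ, Function.update_of_ne hij, Function.update_self] at hc
      rcases hc with hc | hc <;> cases hc; exact Or.inr hT
    · simp only [Function.update_self] at hc
      rcases hc with hc | hc <;> cases hc; exact Or.inl rfl
  have gQ₂ : ∃ c ∈ AddSubgroup.closure (GGset B 2 2), KZ.of rQ₂ - c ∈ KZ.relations := by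
    classical
    refine good_pivots rQ₂ M L e p ℓ₁ ℓ₂ a _ _ h12 (hbox.subset sQ₂) rfl (fun _ _ => rfl)
      (fun l => if l = i then A else Bd) lam ha (fun l l' hl => ?_) fun l c hc => ?_
    · rcases fin_two_eq_or hij l with rfl | rfl
      · simp only [hlT, hhA, Function.update_of_ne hij, Function.update_self] at hl
        rcases hl with hl | hl <;> cases hl
      · simp only [Function.update_self] at hl
        rcases hl with hl | hl <;> cases hl
    · rcases fin_two_eq_or hij l with rfl | rfl
      · simp only [hlT, hhA, Function.update_of_ne hij, Function.update_self] at hc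
        rcases hc with hc | hc <;> cases hc
        exacts [Or.inr hT, Or.inl (if_pos rfl).symm]
      · simp only [Function.update_self] at hc
        rcases hc with hc | hc <;> cases hc
        exacts [Or.inr hT, Or.inl (if_neg hij.symm).symm]
  have gQ₃ : ∃ c ∈ AddSubgroup.closure (GGset B 2 2), KZ.of rQ₃ - c ∈ KZ.relations := by
    refine good_pivot rQ₃ M L e p ℓ₁ ℓ₂ a _ _ h12 (hbox.subset (sQ₃.trans sQ₂)) rfl (fun _ _ => rfl)
      A lam ha fun l c hc => ?_
    rcases fin_two_eq_or hij l with rfl | rfl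
    · simp only [hlT, hhA, Function.update_of_ne hij, Function.update_self] at hc
      rcases hc with hc | hc <;> cases hc
      exacts [Or.inr hT, Or.inl rfl]
    · simp only [Function.update_self] at hc
      rcases hc with hc | hc <;> cases hc
      exacts [Or.inr hT, Or.inl rfl]
  -- assemble: [s] ≡ [T₁] − [Q₁] − [Q₂] + [Q₃]
  have key : KZ.of s - (KZ.of rT₁ - KZ.of rQ₁ - KZ.of rQ₂ + KZ.of rQ₃) ∈ KZ.relations := by
    have := add_mem (sub_mem (sub_mem (sub_mem e₀ e₁) e₂) e₄) e₃
    convert this using 1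
    abel
  exact good_of_sub_mem key (good_add (good_sub (good_sub gT₁ gQ₁) gQ₂) gQ₃)

end SubJanus

end RebaseNest

/-- **Registered part of `stub_rebaseSimpleZero` / `rebaseSimpleZero_nested2` (line `janus-bands`,
v6.2): sub-section Janus for a nested pair.** For a literal `GG B σ 2` datum with nested fibres
`A < tᵢ < tⱼ < B`, letters of common `y`-slope `λ` and a letter-parallel form `T ≤ A ≤ B` on the
base cell, if the literal integrand converges absolutely on the bounded box
`{T < tᵢ < B} × {T < tⱼ < B}` (witnessed by a representation `w` on the box through which the
integrand of `s` factors), the representation is congruent modulo `KZ.relations` to the subgroup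
generated by the literal class `GG B 2 2` (`RebaseNest.subJanus`).
[Kontsevich–Zagier 2001, §1.2, rules (1), (2)] -/
theorem rebaseSimpleZero_nestedSubJanus (B m m' n₁ n₂ : ℕ) (s w : KZ.IntegralRep (B + 1 + 2)) (M : Fin m' → (Fin (B + 1) → ℚ) × ℚ) (L : Fin m → (Fin B → ℚ) × ℚ) (e : Fin m → ℕ) (p : MvPolynomial (Fin B) ℚ) (ℓ₁ ℓ₂ : (Fin B → ℚ) × ℚ) (a : Fin 2 → Option ((Fin (B + 1) → ℚ) × ℚ)) (lo hi : Fin 2 → Fin 2 ⊕ ((Fin (B + 1) → ℚ) × ℚ)) (h12 : n₁ = 0 ∨ n₂ = 0) (hdom : s.domain = {z | (∀ j, 0 < ∑ i, ((M j).1 i : ℝ) * z (Fin.castAdd 2 i) + ((M j).2 : ℝ)) ∧ ∀ i, Sum.elim (fun j => z (Fin.natAdd (B + 1) j)) (fun c => ∑ i', (c.1 i' : ℝ) * z (Fin.castAdd 2 i') + (c.2 : ℝ)) (lo i) < z (Fin.natAdd (B + 1) i) ∧ z (Fin.natAdd (B + 1) i) < Sum.elim (fun j => z (Fin.natAdd (B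 + 1) j)) (fun c => ∑ i', (c.1 i' : ℝ) * z (Fin.castAdd 2 i') + (c.2 : ℝ)) (hi i)}) (hsw : EqOn s.integrand w.integrand s.domain) (i j : Fin 2) (hij : i ≠ j) (A Bd T : (Fin (B + 1) → ℚ) × ℚ) (lam : ℚ) (hloi : lo i = Sum.inr A) (hhii : hi i = Sum.inl j) (hloj : lo j = Sum.inl i) (hhij : hi j = Sum.inr Bd) (ha : ∀ l c, a l = some c → c.1 (Fin.last B) = lam) (hT : T.1 (Fin.last B) = lam) (hTAB : ∀ z : Fin (B + 1 + 2) → ℝ, (∀ r, 0 < ∑ i, ((M r).1 i : ℝ) * z (Fin.castAdd 2 i) + ((M r).2 : ℝ)) → (∑ i', (T.1 i' : ℝ) * z (Fin.castAdd 2 i') + (T.2 : ℝ)) ≤ (∑ i', (A.1 i' : ℝ) * z (Fin.castAdd 2 i') + (A.2 : ℝ)) ∧ (∑ i', (A.1 i' : ℝ) * z (Fin.castAdd 2 i') + (A.2 : ℝ)) ≤ (∑ i', (Bd.1 i' : ℝ) * z (Fin.castAdd 2 i') + (Bd.2 : ℝ))) (hw : w.domain = {z : Fin (B + 1 + 2)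 → ℝ | (∀ r, 0 < ∑ i, ((M r).1 i : ℝ) * z (Fin.castAdd 2 i) + ((M r).2 : ℝ)) ∧ ((∑ i', (T.1 i' : ℝ) * z (Fin.castAdd 2 i') + (T.2 : ℝ)) < z (Fin.natAdd (B + 1) i) ∧ z (Fin.natAdd (B + 1) i) < (∑ i', (Bd.1 i' : ℝ) * z (Fin.castAdd 2 i') + (Bd.2 : ℝ))) ∧ ((∑ i', (T.1 i' : ℝ) * z (Fin.castAdd 2 i') + (T.2 : ℝ)) < z (Fin.natAdd (B + 1) j) ∧ z (Fin.natAdd (B + 1) j) < (∑ i', (Bd.1 i' : ℝ) * z (Fin.castAdd 2 i') + (Bd.2 : ℝ)))}) (hwint : EqOn w.integrand (fun z => MvPolynomial.aeval (fun i => z (Fin.castAdd 2 (Fin.castSucc i))) p / (∏ j, (∑ i, ((L j).1 i : ℝ) * z (Fin.castAdd 2 (Fin.castSucc i)) + ((L j).2 : ℝ)) ^ e j) * ((z (Fin.castAdd 2 (Fin.last B)) - (∑ i, (ℓ₁.1 i : ℝ) * z (Fin.castAdd 2 (Fin.castSucc i)) + (ℓ₁.2 : ℝ))) ^ n₁ /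 (z (Fin.castAdd 2 (Fin.last B)) - (∑ i, (ℓ₂.1 i : ℝ) * z (Fin.castAdd 2 (Fin.castSucc i)) + (ℓ₂.2 : ℝ))) ^ n₂) * ∏ i, (a i).elim 1 (fun c => 1 / (z (Fin.natAdd (B + 1) i) - (∑ i', (c.1 i' : ℝ) * z (Fin.castAdd 2 i') + (c.2 : ℝ))))) w.domain) (hwbd : Bornology.IsBounded w.domain) : ∃ c ∈ AddSubgroup.closure {w : KZ.FormalRep | ∃ (m m' n₁ n₂ : ℕ) (s : KZ.IntegralRep (B + 1 + 2)) (M : Fin m' → (Fin (B + 1) → ℚ) × ℚ) (L : Fin m → (Fin B → ℚ) × ℚ) (e : Fin m → ℕ) (p : MvPolynomial (Fin B) ℚ) (ℓ₁ ℓ₂ : (Fin B → ℚ) × ℚ) (a : Fin 2 → Option ((Fin (B + 1) → ℚ) × ℚ)) (lo hi : Fin 2 → Fin 2 ⊕ ((Fin (B + 1) → ℚ) × ℚ)), (n₁ = 0 ∨ n₂ = 0) ∧ (2 = 2 → (∀ i c, a i = some c → c.1 (Fin.last B) = 0) ∧ (∀ i c, (lo i = Sum.inr c ∨ hi i = Sum.inr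 c) → (c.1 (Fin.last B) = 0 ∨ c = (Pi.single (Fin.last B) 1, 0)))) ∧ Bornology.IsBounded s.domain ∧ s.domain = {z | (∀ j, 0 < ∑ i, ((M j).1 i : ℝ) * z (Fin.castAdd 2 i) + ((M j).2 : ℝ)) ∧ ∀ i, Sum.elim (fun j => z (Fin.natAdd (B + 1) j)) (fun c => ∑ i', (c.1 i' : ℝ) * z (Fin.castAdd 2 i') + (c.2 : ℝ)) (lo i) < z (Fin.natAdd (B + 1) i) ∧ z (Fin.natAdd (B + 1) i) < Sum.elim (fun j => z (Fin.natAdd (B + 1) j)) (fun c => ∑ i', (c.1 i' : ℝ) * z (Fin.castAdd 2 i') + (c.2 : ℝ)) (hi i)} ∧ EqOn s.integrand (fun z => MvPolynomial.aeval (fun i => z (Fin.castAdd 2 (Fin.castSucc i))) p / (∏ j, (∑ i, ((L j).1 i : ℝ) * z (Fin.castAdd 2 (Fin.castSucc i)) + ((L j).2 : ℝ)) ^ e j) * ((z (Fin.castAdd 2 (Fin.last B)) - (∑ i, (ℓ₁.1 i : ℝ) * z (Fin.castAdd 2 (Fin.castSucc i)) + (ℓ₁.2 : ℝ))) ^ n₁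 / (z (Fin.castAdd 2 (Fin.last B)) - (∑ i, (ℓ₂.1 i : ℝ) * z (Fin.castAdd 2 (Fin.castSucc i)) + (ℓ₂.2 : ℝ))) ^ n₂) * ∏ i, (a i).elim 1 (fun c => 1 / (z (Fin.natAdd (B + 1) i) - (∑ i', (c.1 i' : ℝ) * z (Fin.castAdd 2 i') + (c.2 : ℝ))))) s.domain ∧ w = KZ.of s}, KZ.of s - c ∈ KZ.relations := by
  have hset : w.domain = SeparatePos.gDom B 2 m' M
      (Function.update (Function.update lo i (Sum.inr T)) j (Sum.inr T))
      (Function.update (Function.update hi i (Sum.inr Bd)) j (Sum.inr Bd)) :=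
    hw.trans (Set.ext fun z => (RebaseNest.mem_box M hij lo hi T Bd T Bd z).symm)
  have hsub : s.domain ⊆ w.domain := fun z hz => by
    rw [hdom] at hz
    obtain ⟨hr, ⟨h1, h2⟩, -, h4⟩ := (RebaseNest.mem_nest M lo hi hij A Bd hloi hhii hloj hhij z).1 hz
    rw [hset]
    exact (RebaseNest.mem_box M hij lo hi T Bd T Bd z).2
      ⟨hr, ⟨(hTAB z hr).1.trans_lt h1, h2.trans h4⟩, ((hTAB z hr).1.trans_lt h1).trans h2, h4⟩
  have hW := (w.integrableOn.congr_fun hwint (KZ.IntegralRep.measurableSet_domain_holds w)).mono_set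
    hset.symm.subset
  rw [← hset] at hW
  exact RebaseNest.subJanus s M L e p ℓ₁ ℓ₂ a lo hi h12 hdom (fun z hz => (hsw hz).trans (hwint (hsub hz)))
    hij A Bd T lam hloi hhii hloj hhij ha hT (fun z hz => (hTAB z hz).1) (fun z hz => (hTAB z hz).2)
    (hset ▸ hW) (hset ▸ hwbd)

end Summit.KontsevichZagierPeriods.ArrangementNormalForm.JanusBands
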